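import Summits.Ventures.HSemireg.WedgeHankelBox
import Summits.Ventures.HSemireg.WedgeHankelFaces
import Summits.Ventures.HSemireg.WedgeHankelSpikes

/-!
# Venture HSemireg — the TANGENT BOX `Π_i P_{m_i}`, the PURE BOX `(1+t)^{Σ_i m_i}`, the mixed PURE × PAIR box `(1+t)^b · P_c`, and the
# BOX CEILING `Π_i G_{m_i}` attained by the box of middle powers — uniform in the number of factors (the Hankel box law read at Hankel ranks 1, 2, max)

HONEST FRAMING. Part of the Lean index of the computation cell `pub-hsemireg` (seat p10 gen 10, Sunday typer «UNIFORM-IN-n»).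
Finite-dimensional EXTERIOR ALGEBRA over a field and ranks of Hankel matrices ONLY: no variety, no cohomology theory, no sheaf, no Ext
group and no semiregularity map is constructed here; nothing here says that HC / HC_CM / HC_AV holds; no Literature fact is declared or
used.  Custodian versions cited: theory/FORMULA-N.md PART A §2.3 THEOREM K, §2.5 THEOREM T′ («degenerate pairs: (1+t)^b · P_c»), §2.6
THEOREM H and its Kronecker dictionary, §7 FN-1; STRUCTURE.md v1.0-SIGNED 9b196a05977dd067 §1.1 C15 / Σ2.  Dictionary QUOTED, never asserted.

This file only COMPOSES p10 g10's leaves: the HANKEL BOX LAW (`WedgeHankelBox.finrank_range_wedge_hankelBox`: `rank(θ ↦ θ ∧ (v₀ ∧ ⋯ ∧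
v_{n−1}) ∣ ⋀^k) = [t^k] Π_i H_{m_i}(q_i)`) with the one-factor Hankel ranks of the TANGENT sequence `(A,B,0,…,0)` and of ONE EXPONENTIAL `Aλ^j`
(`WedgeHankelFaces`) and with THEOREM H's CEILING and the SPIKE LAW (`WedgeHankelSpikes`).  Results (every field, every `n ≥ 1`, every degree `k`,
all data PER FACTOR):
* §1 one factor: **`hankelPoly_tanSeq`: H_m(A,B,0,…,0) = P_m** (`m ≥ 1`, `B ≠ 0`); **`hankelPoly_expSeq`: H_m(Aλ^j) = (1+t)^m** (`A ≠ 0`).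
* §2 **THE TANGENT BOX: `rank = [t^k] Π_i P_{m_i}`** for factors carrying tangent classes `A_i + B_iΘ_i` (`B_i ≠ 0`, `m_i ≥ 1`) — the same numbers
  as the point-pair / transverse-pair boxes (FN-1's profile does not see WHICH face of Hankel rank 2 a factor carries).
* §3 **THE PURE BOX: `rank = C(Σ_i m_i, k)`** for factors carrying `A_i exp(λ_iΘ_i)` (`A_i ≠ 0`): `Π_i (1+t)^{m_i} = (1+t)^{Σ m_i}` — an external
  product of pure classes is wedge-full on its half of the `Σ_i 2m_i` generators, kernel `C(Σ 2m_i, k) − C(Σ m_i, k)`.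
* §4 **PURE × PAIR = THEOREM T′'s NUMBERS**: a pure factor of dimension `b` and a point-pair factor of dimension `c` give `[t^k] (1+t)^b · P_c` —
  th-6's degenerate-pair / sub-torus-ideal profile (gen 6's `WedgeDegeneratePair`, `(1+t)^b P_c` on ONE factor with `b` common directions) re-appears
  as a two-factor Hankel box (numerical coincidence of profiles; the two models are not identified here).
* §5 coefficientwise bookkeeping in `ℕ[X]` (`coeff_mul_le_of_coeff_le`, `coeff_prod_le_of_coeff_le`); the GENERIC POLYNOMIAL `G_m(t) := Σ_j C(m,j)·min(j+1,
  m+1−j)·t^j` (`genericPoly`); **`coeff_hankelPoly_le`: H_m(q) ≤ G_m coefficientwise for EVERY `q`**; **`hankelPoly_spike_middle`: H_m(δ_{⌊m/2⌋}) = G_m`**.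
* §6 **THE BOX CEILING, UNIFORM IN `n`: `rank(θ ↦ θ ∧ (v₀ ∧ ⋯ ∧ v_{n−1}) ∣ ⋀^k) ≤ [t^k] Π_i G_{m_i}(t)` for EVERY choice of classes `q_i`**
  (`finrank_range_wedge_hankelBox_le`) **and the box of MIDDLE POWERS `Θ_i^{⌊m_i/2⌋}` ATTAINS it** (`finrank_range_wedge_hankelBox_spike_middle`) — the
  ceiling of `WedgeHankelSpikes` multiplied over the factors, sharp for every `n` and every dimensions.
NOT typed: Hankel rank ≥ 3 closed forms other than the spikes; per-q / kernel-name refinements; anything Ext-side.  Class side only.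
Namespace `Summit.Ventures.HSemireg.Wedge.HankelBox` (continued); new names only.
-/

open Module Polynomial

namespace Summit.Ventures.HSemireg.Wedge.HankelBox

open Summit.Ventures.HSemireg.Wedge Summit.Ventures.HSemireg.Wedge.Kunneth Summit.Ventures.HSemireg.Wedge.MixedBox
  Summit.Ventures.HSemireg.Wedge.HankelFaces Summit.Ventures.HSemireg.Wedge.HankelSpikes

variable (K : Type*) [Field K]

/-! ## §1. One factor: the Hankel rank polynomials of the tangent sequence and of one exponential -/

section One

variable (m : ℕ)

/-- **`H_m(A, B, 0, …, 0) = P_m`** (`m ≥ 1`, `B ≠ 0`, `A` arbitrary): the tangent class has the pairs' profile. -/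
theorem hankelPoly_tanSeq (hm : 1 ≤ m) (A : K) {B : K} (hB : B ≠ 0) :
    hankelPoly K m (tanSeq K A B) = PairPowers.pairPoly m := by
  ext k
  rw [coeff_hankelPoly, PairPowers.coeff_pairPoly]
  split_ifs with hk
  · exact choose_mul_rank_hankel1_tanSeq K hm A hB hk
  · rw [Nat.choose_eq_zero_of_lt (by omega), zero_mul]

/-- **`H_m(Aλ^j) = (1+t)^m`** (`A ≠ 0`, every `λ`): the pure class has the binomial profile. -/
theorem hankelPoly_expSeq {A : K} (hA : A ≠ 0) (lam : K) :
    hankelPoly K m (expSeq K A lam) = (1 + X) ^ m := by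
  ext k
  rw [coeff_hankelPoly, coeff_one_add_X_pow, Nat.cast_id]
  rcases Nat.lt_or_ge m k with hk | hk
  · rw [Nat.choose_eq_zero_of_lt hk, zero_mul]
  · rw [rank_hankel1_expSeq K hA lam hk, mul_one]

end One

/-! ## §2. The tangent box -/

section Boxes

variable {n : ℕ} (m : Fin n → ℕ)

/-- **THE TANGENT BOX, UNIFORM IN `n`**: factors of dimensions `m_i ≥ 1` carrying tangent classes `A_i + B_iΘ_i` (`B_i ≠ 0`, `A_i` arbitrary):
`rank(θ ↦ θ ∧ F ∣ ⋀^k) = [t^k] Π_i P_{m_i}(t)` — the point-pair / transverse-pair numbers again. -/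
theorem finrank_range_wedge_hankelBox_tanSeq (hn : 1 ≤ n) (hm : ∀ i, 1 ≤ m i) (A : Fin n → K) {B : Fin n → K}
    (hB : ∀ i, B i ≠ 0) (k : ℕ) :
    finrank K (LinearMap.range (wedge K (Gen m) k (hankelBox K m fun i => tanSeq K (A i) (B i)))) =
      (∏ i : Fin n, PairPowers.pairPoly (m i)).coeff k := by
  rw [finrank_range_wedge_hankelBox K m hn _ k,
    Finset.prod_congr rfl fun i _ => hankelPoly_tanSeq K (m i) (hm i) (A i) (hB i)]

/-- the tangent box in `ℤ[X]` with th-6's `P`: `rank = [t^k] Π_i P_{m_i}`. -/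
theorem finrank_range_wedge_hankelBox_tanSeq_eq_coeff_P (hn : 1 ≤ n) (hm : ∀ i, 1 ≤ m i) (A : Fin n → K) {B : Fin n → K}
    (hB : ∀ i, B i ≠ 0) (k : ℕ) :
    (finrank K (LinearMap.range (wedge K (Gen m) k (hankelBox K m fun i => tanSeq K (A i) (B i)))) : ℤ) =
      (∏ i : Fin n, FormulaN.Uniform.P (m i)).coeff k := by
  rw [finrank_range_wedge_hankelBox_tanSeq K m hn hm A hB k]
  have h : ∀ i : Fin n, (PairPowers.pairPoly (m i)).map (Nat.castRingHom ℤ) = FormulaN.Uniform.P (m i) := by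
    intro i
    ext j
    rw [coeff_map, eq_natCast, PairPowers.coeff_pairPoly_cast]
  rw [← Finset.prod_congr rfl (fun i _ => h i), ← Polynomial.map_prod, coeff_map, eq_natCast]

/-! ## §3. The pure box -/

/-- **THE PURE BOX, UNIFORM IN `n`**: factors carrying `A_i exp(λ_iΘ_i)` (`A_i ≠ 0`, any `λ_i`, any dimensions `m_i`):
`rank(θ ↦ θ ∧ F ∣ ⋀^k) = C(Σ_i m_i, k)` — `Π_i (1+t)^{m_i} = (1+t)^{Σ_i m_i}`: wedge-full on half of the `Σ_i 2m_i` generators. -/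
theorem finrank_range_wedge_hankelBox_expSeq (hn : 1 ≤ n) {A : Fin n → K} (hA : ∀ i, A i ≠ 0) (lam : Fin n → K) (k : ℕ) :
    finrank K (LinearMap.range (wedge K (Gen m) k (hankelBox K m fun i => expSeq K (A i) (lam i)))) =
      (∑ i : Fin n, m i).choose k := by
  rw [finrank_range_wedge_hankelBox K m hn _ k,
    Finset.prod_congr rfl fun i _ => hankelPoly_expSeq K (m i) (hA i) (lam i), Finset.prod_pow_eq_pow_sum,
    coeff_one_add_X_pow, Nat.cast_id]

/-- the pure box kernel: `dim ker = C(Σ_i 2m_i, k) − C(Σ_i m_i, k)`. -/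
theorem finrank_ker_wedge_hankelBox_expSeq (hn : 1 ≤ n) {A : Fin n → K} (hA : ∀ i, A i ≠ 0) (lam : Fin n → K) (k : ℕ) :
    finrank K (LinearMap.ker (wedge K (Gen m) k (hankelBox K m fun i => expSeq K (A i) (lam i)))) =
      (∑ i : Fin n, (m i + m i)).choose k - (∑ i : Fin n, m i).choose k := by
  rw [finrank_ker_wedge_hankelBox K m hn _ k,
    Finset.prod_congr rfl fun i _ => hankelPoly_expSeq K (m i) (hA i) (lam i), Finset.prod_pow_eq_pow_sum,
    coeff_one_add_X_pow, Nat.cast_id]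

end Boxes

/-! ## §4. Pure × pair: THEOREM T′'s numbers as a two-factor Hankel box -/

/-- **A PURE FACTOR OF DIMENSION `b` TIMES A POINT-PAIR FACTOR OF DIMENSION `c`: `rank = [t^k] (1+t)^b · P_c`** (`A ≠ 0`, `a, c' ≠ 0`,
`c ≥ 1`) — th-6's THEOREM T′ profile (degenerate pair with `b` common directions, gen 6's `WedgeDegeneratePair`: `(1+t)^b P_c`) from the
Hankel box law at ranks `1 × 2`. -/
theorem finrank_range_wedge_hankelBox_pure_pair {b c : ℕ} (hc : 1 ≤ c) {A lam a c' : K} (hA : A ≠ 0) (ha : a ≠ 0) (hc' : c' ≠ 0)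
    (k : ℕ) :
    finrank K (LinearMap.range (wedge K (Gen ![b, c]) k
      (hankelBox K ![b, c] fun i => if (i : ℕ) = 0 then expSeq K A lam else ppSeq K c a c'))) =
      ((1 + X) ^ b * PairPowers.pairPoly c).coeff k := by
  rw [finrank_range_wedge_hankelBox K _ (by norm_num) _ k, Fin.prod_univ_two]
  simp only [Fin.val_zero, Fin.val_one, if_true, one_ne_zero, if_false, Matrix.cons_val_zero, Matrix.cons_val_one]
  rw [hankelPoly_expSeq K b hA lam, hankelPoly_ppSeq K c hc ha hc']

/-- the two mixed rows of gen 6 re-read: a CURVE pure factor times a SURFACE point pair, `(1+t)(1+4t+t²) = (1,5,5,1)` — the numbers of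
`WedgeMixedBox.mixedRank_rows`' first row AND of THEOREM T′'s `(1+t)·P_2`, now as `[t^k] (1+X)^1 · pairPoly 2` (closed coefficients by `decide`). -/
theorem pure_pair_row :
    (((1 + X) ^ 1 * PairPowers.pairPoly 2).coeff 0, ((1 + X) ^ 1 * PairPowers.pairPoly 2).coeff 1,
      ((1 + X) ^ 1 * PairPowers.pairPoly 2).coeff 2, ((1 + X) ^ 1 * PairPowers.pairPoly 2).coeff 3) = (1, 5, 5, 1) := by
  have h : ∀ k, ((1 + X) ^ 1 * PairPowers.pairPoly 2).coeff k =
      ∑ i ∈ Finset.range (k + 1), (Nat.choose 1 i) * (if k - i ≤ 2 then WedgePair.pointPairRank 2 (k - i) else 0) := by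
    intro k
    rw [coeff_mul, Finset.Nat.sum_antidiagonal_eq_sum_range_succ
      (fun i j => ((1 + X : Polynomial ℕ) ^ 1).coeff i * (PairPowers.pairPoly 2).coeff j) k]
    refine Finset.sum_congr rfl fun i _ => ?_
    rw [coeff_one_add_X_pow, Nat.cast_id, PairPowers.coeff_pairPoly]
  simp only [h]
  decide

/-! ## §5. Coefficientwise bookkeeping in `ℕ[X]`; the generic polynomial `G_m` -/

/-- products are coefficientwise monotone in `ℕ[X]`. -/
lemma coeff_mul_le_of_coeff_le {f f' g g' : Polynomial ℕ} (hf : ∀ k, f.coeff k ≤ f'.coeff k) (hg : ∀ k, g.coeff k ≤ g'.coeff k) (k : ℕ) :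
    (f * g).coeff k ≤ (f' * g').coeff k := by
  rw [coeff_mul, coeff_mul]
  exact Finset.sum_le_sum fun x _ => Nat.mul_le_mul (hf _) (hg _)

/-- finite products are coefficientwise monotone in `ℕ[X]`. -/
lemma coeff_prod_le_of_coeff_le {ι : Type*} (s : Finset ι) {f g : ι → Polynomial ℕ}
    (h : ∀ i ∈ s, ∀ k, (f i).coeff k ≤ (g i).coeff k) (k : ℕ) :
    (∏ i ∈ s, f i).coeff k ≤ (∏ i ∈ s, g i).coeff k := by
  classical
  induction s using Finset.induction_on generalizing k with
  | empty => simp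
  | insert a s ha ih =>
    rw [Finset.prod_insert ha, Finset.prod_insert ha]
    exact coeff_mul_le_of_coeff_le (h a (Finset.mem_insert_self a s))
      (fun k => ih (fun i hi => h i (Finset.mem_insert_of_mem hi)) k) k

section Generic

variable (m : ℕ)

/-- the GENERIC POLYNOMIAL `G_m(t) := Σ_{j ≤ m} C(m,j)·min(j+1, m+1−j)·t^j` (THEOREM H's ceiling, degree by degree). -/
noncomputable def genericPoly : Polynomial ℕ :=
  ∑ j ∈ Finset.range (m + 1), monomial j (m.choose j * min (j + 1) (m + 1 - j))

/-- coefficients of the generic polynomial (all `k`; `0` above `m` by `C(m,k) = 0`). -/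
lemma coeff_genericPoly (k : ℕ) : (genericPoly m).coeff k = m.choose k * min (k + 1) (m + 1 - k) := by
  rw [genericPoly, finsetSum_coeff]
  simp_rw [coeff_monomial]
  rw [Finset.sum_ite_eq']
  split_ifs with h
  · rfl
  · rw [Finset.mem_range, not_lt] at h
    rw [Nat.choose_eq_zero_of_lt (by omega), zero_mul]

/-- **`H_m(q) ≤ G_m` coefficientwise for EVERY sequence `q`** (THEOREM H's ceiling, `WedgeHankelSpikes.rank_hankel1_le`). -/
theorem coeff_hankelPoly_le (q : ℕ → K) (k : ℕ) : (hankelPoly K m q).coeff k ≤ (genericPoly m).coeff k := by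
  rw [coeff_hankelPoly, coeff_genericPoly]
  exact Nat.mul_le_mul_left _ (rank_hankel1_le K m k q)

/-- **`H_m(δ_{⌊m/2⌋}) = G_m`**: the middle power's Hankel rank polynomial IS the generic polynomial. -/
theorem hankelPoly_spike_middle : hankelPoly K m (spikeSeq K (m / 2)) = genericPoly m := by
  ext k
  rw [coeff_hankelPoly, coeff_genericPoly]
  rcases Nat.lt_or_ge m k with hk | hk
  · rw [Nat.choose_eq_zero_of_lt hk, zero_mul, zero_mul]
  · rw [rank_hankel1_spike_middle K hk]

end Generic

/-! ## §6. The box ceiling, uniform in `n`, attained by the box of middle powers -/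

section Ceiling

variable {n : ℕ} (m : Fin n → ℕ)

/-- **THE BOX CEILING: `rank(θ ↦ θ ∧ (v₀ ∧ ⋯ ∧ v_{n−1}) ∣ ⋀^k) ≤ [t^k] Π_i G_{m_i}(t)` for EVERY classes `q_i`** (every field, `n ≥ 1`, every `k`). -/
theorem finrank_range_wedge_hankelBox_le (hn : 1 ≤ n) (q : Fin n → ℕ → K) (k : ℕ) :
    finrank K (LinearMap.range (wedge K (Gen m) k (hankelBox K m q))) ≤ (∏ i : Fin n, genericPoly (m i)).coeff k := by
  rw [finrank_range_wedge_hankelBox K m hn q k]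
  exact coeff_prod_le_of_coeff_le _ (fun i _ k => coeff_hankelPoly_le K (m i) (q i) k) k

/-- **THE BOX CEILING IS ATTAINED by the box of middle powers `Θ_i^{⌊m_i/2⌋}/⌊m_i/2⌋!`: `rank = [t^k] Π_i G_{m_i}(t)`** (every field, `n ≥ 1`, `k`). -/
theorem finrank_range_wedge_hankelBox_spike_middle (hn : 1 ≤ n) (k : ℕ) :
    finrank K (LinearMap.range (wedge K (Gen m) k (hankelBox K m fun i => spikeSeq K (m i / 2)))) =
      (∏ i : Fin n, genericPoly (m i)).coeff k := by
  rw [finrank_range_wedge_hankelBox K m hn _ k,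
    Finset.prod_congr rfl fun i _ => hankelPoly_spike_middle K (m i)]

end Ceiling

end Summit.Ventures.HSemireg.Wedge.HankelBox
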